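import Mathlib
import HarnessLib
import HarnessLib.Audit
import Summits.AtomisticToContinuum.Statement
import Literature.MathematicalPhysics.QuantumLattice.SpinSystem
import Summits.AtomisticToContinuum.BoseEinsteinCondensation.Theorems.BECInfraredBoundAssembly

/-!
Route: BECHierarchicalGluing

CLOSED (retired) 2026-08-15T13:38:45Z by operator:999:1257524 — reason: not-a-thesis: assembly does not conclude the sub-problem Statement — note: D-0027 §2.1 audit (human 2026-08-15: routes that do not decide the summit are removed): the assembly concludes `Literature.MathematicalPhysics.QuantumManyBody.BoseGas.BoseEinsteinCondensation`, not the sub-problem statement; a NEW conforming route may be opened from the same idea (generated `closes . The file is kept as the record of this route; refuted decls are indexed as negative knowledge (`ledger negatives`).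

# Route BECHierarchicalGluing — Dyson's trick for BEC — exact Josephson gluing across gapless scales
in the hierarchical hard-core Bose gas (order iff q b² > 1), a typed rung under the zero-mode
endpoint

It suffices to show X = HierCondensation ∧ ZeroModeOccupation (card
hierarchical-bose-hubbard-exact-gluing, in its hard-core form). HierCondensation (the RUNG, new
mathematics, fully typed): hard-core bosons on the b-adic hierarchy Λ_M = (Fin M → Fin b) with
Dyson-hierarchical hopping H = Σ_(n=1..M) q^n Σ_(x ~_n y) (δ_xy − b^(−n)) a†_x a_y = Σ_n q^n
Σ_(B∈𝔅_n) (N_B − a_B† a_B) (a_B = |B|^(−1/2) Σ_(x∈B) a_x; one-body spectrum q^n with NO uniform gap,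
spectral dimension d_s = 2 ln b / ln(1/q); b = 8, q = 1/4 is the card's L = 2, α = 2, d_s = 3) has,
whenever q b² > 1 (⇔ d_s > 1), ground-state BEC uniformly in the depth M in every filling window ν₁
b^M ≤ N ≤ ν₀ b^M: b^(−M) ⟨Σ_(x,y) a†_x a_y⟩ ≥ c N. KEY IDENTITY (planner's check of the card's
"exact recursion"): with a† = S⁺ the model is the spin-½ Dyson-hierarchical XY ferromagnet at fixed
magnetisation, H = const(N) − Σ_n (q/b)^n Σ_(B∈𝔅_n) [(S¹_B)² + (S²_B)² + S³_B], so the level-n term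
sees sub-blocks ONLY through their total spins (CasimirConservation) and level 1 is the complete
graph K_b (Tóth/Penrose, Dicke states, gap q). The rung is proved by a level recursion whose content
is ONE typed inequality, SiblingCoherence (per-level sibling coherence deficit ≤ C θ^ℓ, predicted θ
= (q b²)^(−1/2) = √(E_C/E_J) ratio per level), telescoped exactly to the top mode
(CoherenceTelescoping). ZeroModeOccupation is the continuum endpoint X_B1 (constant-mode occupation
≥ cN of Dirichlet near-minimisers; shared with BECInfraredBound / BECRenormGroup /
BECPalmLandscape), whose implication to the conjunct is PROVED
(AtomisticToContinuum.BECInfraredBound.bec_of_zeroMode). Honest scope: no hierarchical → Euclidean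
transfer is claimed; the rung isolates and proves the multiscale-gluing half of X_B1 (the step every
continuum programme — Junge2026 Remark 7, card coherence-angle-scale-chaining, route BECRenormGroup
crux 0693 — currently cannot do) in the one interacting model where the Josephson block recursion is
an identity, and the dial q b² ≶ 1 (NoCondensationBelowThreshold) certifies that the mechanism, not
an artefact, is what is proved.
Lean: `HierCondensation ∧ ZeroModeOccupation`

## Assembly
Pure logic today: the last hypothesis is X_B1 verbatim and
`AtomisticToContinuum.BECInfraredBound.bec_of_zeroMode : X_B1 → BoseEinsteinCondensation` is proved
in Theorems/BECInfraredBoundAssembly.lean (occupation of the normalised constant mode ≤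
maxOccupation ≤ condensateNumber), so `fun _ _ _ h => bec_of_zeroMode h` closes the assembly
(checked rc 0 in Sketch.lean). The first three hypotheses are the rung spine (SiblingCoherence →
CoherenceTelescoping → HierCondensation is itself a provable implication: ε_ℓ := Cθ^(ℓ+1), ⟨N̂⟩ =
N‖v‖² in the sector, Π_ℓ max(1/b, ·) ≥ Π_(ℓ≥0)(…) > 0); they are displayed in the assembly because
they are the route's deliverable, not because the continuum implication uses them — no hierarchical
→ Euclidean transfer exists or is claimed.

Rationale: WHY THIS LINE. Dyson (Dyson1969) made the 1/r² Ising chain tractable by replacing it with a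
hierarchical model in which the renormalisation group is exact; Bleher–Major (BleherMajor1984,
BleherMajor1989) ran that programme through the Goldstone scales of the classical hierarchical
VECTOR model, and Gawędzki–Kupiainen (GawedzkiKupiainen1985) through massless φ⁴ — always classical
measures. Here the same move is made on the interacting Bose gas: with hierarchical hopping the
inter-block coupling is EXACTLY a function of the block condensate modes (a_B, N_B) — for hard cores
literally of the block total spins — so Anderson–Leggett Josephson block gluing (Leggett2001 §VI:
⟨δθ²⟩ ≍ √(E_C/E_J)) becomes a finite-dimensional quantum recursion with a UNIFORM small parameter:
E_C^(n−1)/E_J^(n) ≍ 2(q b²)^(−(n−1))/((1−q) f ρ(1−ρ)), summable iff q b² > 1, and level 1 is the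
solved complete-graph gas (Toth1990, Penrose1991, Kirson2000, BruDorlas2003). Imported areas: exact
hierarchical RG (constructive field theory), exactly solvable mean-field bosons,
Josephson/quantum-rotor energetics; cross-check dictionary to long-range chains: laid on a line the
couplings are J(r) ≍ r^(−(1 + ln(1/q)/ln b)), and q b² > 1 ⇔ exponent < 3 is exactly the T = 0
continuous-symmetry-breaking threshold found for long-range XXZ/XY chains
(MaghrebiGongGorshkov2017), q b > 1 ⇔ exponent < 2 the thermal (Dyson) one. What no prior route
does: BECInfraredBound/BECPinning/BECPalmLandscape attack X_B1 by one global estimate,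
BECRenormGroup by an untypable functional-integral RG; this route supplies the first interacting
Bose model in which thermodynamic-limit BEC THROUGH A CLOSING GAP (gap q^M = |Λ|^(−2/d_s)) is a
typed, plausibly provable theorem, with the dimension dial on display; negatives index empty
(2026-08-15).

RANKED CRUXES. #0 Target (target) — X = HierCondensation ∧ ZeroModeOccupation (rung theorem ∧
continuum zero-mode endpoint). (why it might fail: the second conjunct is the open BEC problem in
X_B1 form; the first fails if hierarchical supersite Mott/glass physics invades every filling window
(see SiblingCoherence).) [Penrose1991, LSSY2005, Leggett2001, BleherMajor1984]
#2 SiblingCoherence (crux) — card H1 in typed form. For b ≥ 2, 0 < q < 1 with q b² > 1 there are ν₀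
> 0 and, for every filling floor 0 < ν₁ ≤ ν₀, a rate 0 ≤ θ < 1 and C such that for every depth M,
every N with ν₁ b^M ≤ N ≤ ν₀ b^M and every sector-N ground state v of H (Rayleigh minimiser in the
sector; unique and positive by Perron–Frobenius), at every level ℓ < M and for every pair of SIBLING
blocks B ≠ B′ of level ℓ (same parent), with A_B = Σ_(y∈B) a_y: Re⟨v, A_B† A_B′ v⟩ ≥ 0 and Re⟨v,
A_B† A_B′ v⟩ ≥ (1 − C θ^(ℓ+1)) · ½(⟨v, A_B† A_B v⟩ + ⟨v, A_B′† A_B′ v⟩). Predicted θ = (q b²)^(−1/2)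
(zero-point relative phase of sibling rotors, ½⟨δθ²⟩ ≍ ½√(E_C/E_J)); big blocks are MORE coherent.
[difficulty: L] (why it might fail: level-1 blocks are supersites with U_eff = 2q/b, hopping q²/b:
mean-field Mott lobes at fillings k/b when q(b−1) ≲ 0.34 (inside q b² > 1 for q < 0.049, b = 8); if
incoherent low levels feed E_J ∝ f_ℓ → 0 upward, no window ν₀ works.) [Leggett2001, FisherEtAl1989,
Penrose1991, BleherMajor1984, MaghrebiGongGorshkov2017]
#3 NoCondensationBelowThreshold (crux) — the dial (card H2, negative side). For b ≥ 2 and 0 < q with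
q b² < 1 (d_s < 1; on a line: coupling exponent > 3), at every filling floor ν₁ > 0 the zero-mode
fraction of the sector ground state tends to 0: ∀ c > 0 ∃ M₀ ∀ M ≥ M₀ ∀ N ≥ ν₁ b^M: b^(−M)⟨v,
Σ_(x,y) a†_x a_y v⟩ ≤ c N ⟨v, v⟩. Mechanism: E_C/E_J GROWS like (q b²)^(−ℓ), sibling phases at the
top levels are quantum-disordered rotors, and CoherenceTelescoping's factors stay below 1 − η at
every high level. [difficulty: L] (why it might fail: needs a LOWER bound on block charging energies
(finite compressibility of superfluid sub-blocks, E_C ≥ c b^(−ℓ)) and an upper bound on coherence of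
strongly quantum rotors uniformly in the sub-block state; near q b² = 1 the crossover level diverges
and constants must not.) [MaghrebiGongGorshkov2017, Dyson1969, Leggett2001, PitaevskiiStringari1991]
#4 HierCondensation (crux) — the rung theorem (card THEOREM-CANDIDATE HierBEC, hard-core form). For
b ≥ 2, 0 < q < 1, q b² > 1: ∃ ν₀ > 0 ∀ ν₁ ∈ (0, ν₀] ∃ c > 0 ∀ M ≥ 1 ∀ N with ν₁ b^M ≤ N ≤ ν₀ b^M,
every sector-N ground state v of H has b^(−M) Re⟨v, (Σ_(x,y) a†_x a_y) v⟩ ≥ c N ⟨v, v⟩ (occupation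
of the block-constant top mode a_Λ = b^(−M/2) Σ_x a_x, i.e. λ_max(γ) ≥ cN; maximal possible value
N(1 − ρ) + ρ). Follows from SiblingCoherence + CoherenceTelescoping (Π_ℓ max(1/b, 1 −
(1−1/b)Cθ^(ℓ+1)) > 0 uniformly in M); a DIRECT proof by a different engine (Tóth's random-stirring /
interchange representation on the hierarchy, or a Bleher–Major-type recursion on block generating
functions) is equally welcome. [deps: SiblingCoherence, CoherenceTelescoping] [difficulty: L] (why
it might fail: for 1 < d_s ≤ 2 (b⁻² < q ≤ b⁻¹) the dilute limit is strongly coupled (c(ν₁) → 0 as ν₁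
→ 0, Tonks-like), so any proof uniform in the window must be non-perturbative at the ~log_b(1/ν₁)
lowest populated levels; commensurate supersite lobes bound ν₀(b, q) above.) [Penrose1991, Toth1990,
Kirson2000, BruDorlas2003, BleherMajor1989, Dyson1969]
#5 ZeroModeOccupation (crux) — the continuum endpoint X_B1 (verbatim the hypothesis of
AtomisticToContinuum.BECInfraredBound.bec_of_zeroMode; shared decl with
BECInfraredBound.BecZeroModeThesis / stmt-AtomisticToContinuum-0686): for every repulsive
finite-range v there is ρ₀ > 0 such that for 0 < ρ < ρ₀ there is c > 0 with, for all large N, some δ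
> 0 such that every Dirichlet trial state in the box of side (N/ρ)^(1/3) with energy ≤ E₀ + δ has
occupation of the normalised constant mode ≥ cN. The rung's SiblingCoherence/CoherenceTelescoping
are the exact hierarchical form of the multiscale step (dyadic block-constant modes: φ_parent =
8^(−1/2) Σ φ_child holds verbatim in the continuum, so the SAME linear telescoping reduces X_B1 to a
summable per-scale sibling-coherence bound above the Fournais window plus local condensation below
it). [difficulty: open-problem] (why it might fail: it is the open problem; in the continuum the
inter-block coupling does NOT factor through block modes (boundary couplings, all momenta), so the
per-scale engine that is an identity here is conjectural there (KineticGapLengthScales bites at each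
scale if only energy is used).) [LSSY2005, Fournais2020, Junge2026, Leggett2001]
#9 CoherenceTelescoping (support) — exact block bookkeeping, ANY vector v, any ε : ℕ → ℝ: if at
every level ℓ < M every sibling pair (B, B′) has Re⟨A_B† A_B′⟩ ≥ 0 and Re⟨A_B† A_B′⟩ ≥ (1 −
ε_ℓ)·½(⟨A_B†A_B⟩ + ⟨A_B′†A_B′⟩), then ⟨Σ_x a†_x a_x⟩ · Π_(ℓ<M) max(1/b, 1 − (1 − 1/b) ε_ℓ) ≤ b^(−M)
⟨Σ_(x,y) a†_x a_y⟩ (because A_parent = Σ_children A_B exactly: Σ_(j,k) G_jk ≥ b·max(1/b, 1 −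
(1−1/b)ε)·Σ_j G_jj, iterated from sites to Λ). Finite sums and Cauchy–Schwarz only. [difficulty:
provable-now] [PenroseOnsager1956, Leggett2001]
#9 LevelOneDicke (support) — level 1 = complete graph K_b (card H0): for M = 1, H = q(N̂ − b⁻¹
S⁺_tot S⁻_tot), so every sector-N Rayleigh minimiser (N ≤ b) maximises ⟨S⁺S⁻⟩ = S(S+1) − m² + m at S
= b/2, m = N − b/2: ⟨v, Σ_(x,y) a†_x a_y v⟩ = N(b − N + 1)⟨v, v⟩ exactly (Dicke states; condensate
fraction (b − N + 1)/b, gap q·1 in every sector). [difficulty: provable-now] [Penrose1991, Toth1990,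
Tasaki2020]
#9 CasimirConservation (support) — exactness of the recursion (the audits' cheap test (b), typed):
for levels ℓ′ ≤ ℓ and any sites x, z, the level-ℓ block hopping form Σ_(y,y′∈B_ℓ(x)) a†_y a_y′ =
S⁺_B S⁻_B commutes with the total-spin Casimir Σ_α (Σ_(w∈B_ℓ′(z)) S^α_w)² of the level-ℓ′ block of z
(blocks are nested or disjoint; S⁺_B S⁻_B = S_B² − (S³_B)² + S³_B is a polynomial in the components
of S_B = S_B′ + S_rest). Hence every level-n term of H conserves all lower-level block Casimirs:
sub-blocks enter only through their total spins. [difficulty: provable-now] [Tasaki2020,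
Penrose1991]

TWO-LAYER PLAN. Foreseen glued splits (nothing filed now). SiblingCoherence ⇐ ChargingBound →
JosephsonStiffness → SiblingCoherence, where ChargingBound (typed and rc 0 in Sketch.lean as
ChargingBoundForeseen: sector energies satisfy E(N+1) − 2E(N) + E(N−1) ≤ C b^(−M) in the window,
i.e. E_C^(M) ≲ 2q/((1−q)b^M), by zero-mode insertion/removal trial states) and JosephsonStiffness
(relative-phase twist of one child costs ≥ c q^(ℓ+1) f ρ b^ℓ θ²: lower bound on E_J from the
children's own coherence = the induction hypothesis one level down) combine through the two-mode
uncertainty/virial inequality ⟨A*[H,A]⟩ ≥ 0 for A = relative number / relative current of a sibling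
pair (the pair is exactly harmonic to leading order here). HierCondensation ⇐ SiblingCoherence →
CoherenceTelescoping → HierCondensation (glue provable now). NoCondensationBelowThreshold ⇐
ChargingFloor (E_C^(ℓ) ≥ c′ b^(−ℓ), finite compressibility) → RotorDisorder (coherence of b coupled
rotors ≤ C(E_J/E_C)^(1/2) when E_J ≪ E_C) → NoCondensationBelowThreshold. ZeroModeOccupation ⇐
ContinuumSiblingCoherence (dyadic Neumann/Dirichlet sub-cubes above the Fournais window, summable
deficits) → WindowBase (local condensation, Fournais2020/Junge2026) → ZeroModeOccupation — shared
with whatever route realises card coherence-angle-scale-chaining; this route contributes the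
induction hypothesis and constants that survive in the exact model.

KILL CRITERIA. Refutation of SiblingCoherence for some (b, q) with q b² > 1 in EVERY filling window
(e.g. exact diagonalisation / DMRG on the b = 2 hierarchical XY chain showing sibling deficits that
do not decay with the level for q ∈ (1/4, 1), or a proof of a gapped incoherent phase at all small
fillings) closes the route `refuted:SiblingCoherence` unless HierCondensation is proved directly
(then restate rank 2 with the observed rate). Refutation of HierCondensation closes the route
outright and retires the card (the mechanism would be an artefact of heuristics). Refutation of
NoCondensationBelowThreshold (order below threshold) kills the dial reading and forces a pivot of
the thesis text (the rung survives). ZeroModeOccupation refuted (¬X_B1 for some admissible v) breaks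
this route together with BECInfraredBound/BECRenormGroup/BECPalmLandscape — pivot the continuum
endpoint to HasGroundStateBEC directly. X_B1 proved elsewhere moots the continuum half; the rung
then remains as a Literature-grade theorem and closes `superseded`.

NOT DECOMPOSED YET. Deliberately not filed: the charging/compressibility bound and the Josephson
stiffness bound (layer-2 children of SiblingCoherence, above); Perron–Frobenius
uniqueness/positivity of the sector ground state (a `--supports` lemma over
Literature.MathematicalPhysics.QuantumLattice.PerronFrobeniusGroundState); the identification ⟨N̂⟩ =
N‖v‖² on the sector and onSite multiplicativity (bookkeeping); the sharp rate θ = (q b²)^(−1/2) and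
the d_s > 2 refinement (constants uniform down to N = 1 when q b > 1); the marginal case q b² = 1
(logarithmic decoherence, algebraic order — not claimed either way); the soft-core (finite U)
version of the card; the continuum children of ZeroModeOccupation (other routes' cruxes); any
hierarchical → Euclidean transfer (none is claimed: Gawędzki–Kupiainen-type "hierarchical +
remainder" expansions do not exist for interacting bosons, and operator comparison T_h ≤ C(−Δ) alone
runs into KineticGapLengthScales).

CHEAPEST FALSIFIER. (i) Algebra (typed as CasimirConservation): the level-n term sees sub-blocks
only through their total spins — checked by hand; ten lines for a refuter. (ii) Toy ED done here
(pure-Python Lanczos, toy/hier_ed.py): b=4, M=1 reproduces LevelOneDicke exactly; b=4, M=2, N=4 (16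
sites): all ⟨a†_x a_y⟩ ≥ 0 and the dial shows — top sibling deficit 0.14/0.22/0.66/0.91, n₀/N =
0.79/0.76/0.49/0.32 (max 0.81) for q = 0.9/0.5/0.15/0.05 (q b² = 14.4/8/2.4/0.8). CAVEAT: the
geometric regime needs E_C/E_J ≍ 2(q b²)^(−(ℓ−1))/((1−q) f ρ(1−ρ)) < 1; for b = 2 that is ℓ ≥ 8 (≥
256 sites): ED (M ≤ 5) sees only non-perturbative low levels, where deficits legitimately grow, and
cannot test the rate. (iii) Real cheap test (kit, hours, not run): H is stoquastic ⇒ sign-free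
worm/SSE QMC at β ≫ q^(−M), b = 8, M = 3–4 (≤ 4096 sites, fillings 1/16–1/4, q ∈ {1/8, 1/4, 1/2}),
or DMRG on the b = 2 chain, M = 8–9: prediction ε_(ℓ+1)/ε_ℓ → (q b²)^(−1/2) once E_C/E_J < 1, n₀/N
convergent in M; for q b² < 1 top deficits → 1. Flat ε_ℓ over three perturbative levels at q b² ≥ 4
kills SiblingCoherence. (iv) Consistency (done): thresholds q b² = 1 / q b = 1 ↔ chain exponents 3 /
2 (MaghrebiGongGorshkov2017; Dyson1969).

NUMBERS. Dictionary: block size b^n, level coupling q^n (κ = 1); d_s = 2 ln b/ln(1/q); line exponent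
1 + ln(1/q)/ln b; card's (L, α) = (b^(1/3), −3 ln q/ln b… i.e. q = L^(−α), b = L³); physical point b
= 8, q = 1/4: d_s = 3, exponent 5/3, per-level Josephson improvement q b² = 16, predicted θ = 1/4.
Level 1 (K_b): E₁(N) = (q/b)(N² − (b+1)N), U_eff = E₁″ = 2q/b, condensate N(b−N+1)/b, gap q. Level-2
supersite Bose–Hubbard: hopping J = q²/b between siblings, z = b − 1, U/(zJ) = 2/((b−1)q);
mean-field Mott lobe at integer supersite filling iff U/(zJ) > 3 + 2√2 ≈ 5.83 (FisherEtAl1989) ⇔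
q(b−1) < 0.343; for b = 8 the lobe window 1/64 < q < 0.049 lies inside q b² > 1, hence ν₀ < 1/b.
Charging E_C^(n) ≈ 2q/((1−q) b^n); Josephson E_J^(n) ≈ q^n f ρ(1−ρ) b^(n−1); ratio r_n ≈ 2(q
b²)^(−(n−1))/((1−q) f ρ(1−ρ)); ½⟨δθ²⟩ ≍ ½√r_n. Thresholds: T = 0 order iff q b² > 1 (exponent < 3,
MaghrebiGongGorshkov2017: α_c ≈ 3 for the LR XXZ chain); thermal iff q b > 1 (exponent < 2,
Dyson1969). Continuum comparison: E_C/E_J ∝ ℓ^(−4) per octave in d = 3 (Leggett2001 §VI) = (q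
b²)^(−1) = 1/16 per level at b = 8, q = 1/4. Items at open: 9 (4 cruxes).

DEFINITION REQUESTS. None needed for the typed items
(Literature.MathematicalPhysics.QuantumLattice.Op/onSite/spinRaise/spinLower/siteSpin exist; the
Hamiltonian, block modes and the sector ground state are inlined as hypotheses `H = …`, `A = …`).
Nice-to-have (filed after open if the gate accepts): definition `hierarchicalHardCoreGas (M b : ℕ)
(q : ℝ) : Op (Fin M → Fin b) 2` and `blockMode` under Literature/MathematicalPhysics/QuantumLattice
so that restated items shrink; cite facts wanted: Penrose1991 Thm (complete-graph BEC at all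
densities), MaghrebiGongGorshkov2017 (physics-level threshold, for the barrier catalogue's
low-dimension entries).

Novelty: Searches (2026-08-15): `lit search --source zbmath "Dyson hierarchical quantum spin"` (8:
Moreira–Schor 1994 doi:10.1007/bf02103277 quantum hierarchical criticality; Monthus 2015
arXiv:1506.06012 hierarchical quantum spin glass; Pappalardi–Calabrese–Parisi 2019 arXiv:1904.00015;
Albeverio–Kondratiev–Kozitsky doi:10.1023/a:1007347116692 — all T > 0 / critical /
anharmonic-oscillator, none U(1) at fixed magnetisation), `lit search --source zbmath "hierarchical
model quantum"` (40 rows; adds Gallavotti–Jauslin / Benfatto–Gallavotti–Jauslin 2015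
arXiv:1506.04381 hierarchical Kondo — a fermionic quantum many-body hierarchical model treated by
exact RG, the closest methodological kin; Kritchevski hierarchical Anderson model;
Molchanov–Vainberg hierarchical Schrödinger operator), `lit search --source zbmath "hierarchical XY
model quantum rotor ground state long-range order"` (0), `lit search --source crossref
"Bose-Einstein condensation hierarchical lattice interacting bosons"` (25, none hierarchical;
Kirson2000 complete graph), `lit search --source crossref` on long-range XXZ chains
(MaghrebiGongGorshkov2017 anchor), `lit galaxy search --star all` ×4: "hierarchical XY model" (0),
"quantum hierarchical model" (1 irrelevant), "Dyson hierarchical" (10: von Soosten–Warzel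
arXiv:1705.04884 hierarchical operators, H^(2|2) on the hierarchical lattice, Monthus, Hutchcroft
long-range percolation — no bosons), "hierarchical Bose-Hubbard" (0); `lit frontier
AtomisticToContinuum --since 2021`  [refs: 10.1007/bf02103277, 10.1023/a:1007347116692, 10.1214/aop/1176989919., 1506.06012, 1904.00015, 1506.04381, 1705.04884, 2603.20776, 2510.20493, 2602.16566, 2209.11714, doi:10.1007/bf02103277, doi:10.1023/a, doi:10.1214/aop/1176989919., Kirson2000, MaghrebiGongGorshkov2017, Junge2026, BleherMajor1984, BleherMajor1989, Penrose1991, Toth1990, BruDorlas2003, Dyson1969, GawedzkiKupiainen1985]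

Barriers (technique_class: hierarchical-model real-space-rg josephson-blocks): - technique_class: hierarchical-model real-space-rg josephson-blocks
- Literature.Barriers.AtomisticToContinuum.KineticGapLengthScales: met head-on and paid per level,
not evaded by a gap — the one-body gap q^M = |Λ|^(−2/d_s) closes; no step multiplies (block size)² ×
excess energy: the per-level price is √(E_C/E_J) ≍ (q b²)^(−ℓ/2), summable. The narrowed entry
KineticGapLengthScalesNarrow (energy-window arguments certify ≤ N/(M+1)) does not bind:
SiblingCoherence is stated for the exact sector ground state (eigenvalue equation, Perron–Frobenius
positivity, second variation available), not for an energy window.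
- Literature.Barriers.AtomisticToContinuum.BogoliubovPerturbationInfrared: evaded structurally — no
expansion around an infinite-volume Bogoliubov state and no sum over scales inside a perturbation
series; Bogoliubov/two-mode theory is used only for FINITE gapped level problems (b coupled rotors),
and the infrared sum is the convergent product Π(1 − Cθ^ℓ) performed by CoherenceTelescoping; the
complex-measure large-field problem never arises (operator statements, stoquastic H).
BogoliubovPerturbationInfraredNarrow: same answer, nothing is finite-order perturbation theory in ψ.
- Literature.Barriers.AtomisticToContinuum.HalfFillingReflectionPositivity: not used — hierarchical
couplings are neither translation-invariant nor reflection positive; any filling window ν₁ ≤ N/|Λ| ≤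
ν₀; the bet is precisely an RP-free order mechanism (exact scale recursion).
- Literature.Barrie

Novelty grade: new-combination — ROUTE REVIEW rreview-7b9376c7 (refuter) 2026-08-15 — route CLOSED retired by operator 13:38:45Z ('not-a-thesis: assembly does not conclude the sub-problem Statement') during review; findings for any repair. ELAB: W1.lean rc0 for all 7 decls (6186, 6187, 6188, 0686, 6189, 6190, 6191). ASSEMBLY 6192 P (refuter refuter-rreview-route-AtomisticToContinu-7b9376c7-0, 2026-08-15T13:48:36Z; prior: Dyson1969; BleherMajor1984; BleherMajor1989; GawedzkiKupiainen1985; Toth1990; Penrose1991; Kirson2000; BruDorlas2003; Leggett2001; MaghrebiGongGorshkov2017; arXiv:1506.04381)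

History (route lifecycle, newest last):
- 2026-08-15T12:13:33Z · rev 2: dropped Target — drop the optional rank-0 Target: it forward-references route decls (HierCondensation, ZeroModeOccupation) that the gate defines later in the file, so it rendere (planner-plancard-AtomisticToContinuum-BoseEin-0a6d29ed-0)
- 2026-08-15T12:16:45Z · rev 2: dropped Target — drop the optional rank-0 Target: it forward-references route decls (HierCondensation, ZeroModeOccupation) that the gate defines later in the file, so it rendere (planner-plancard-AtomisticToContinuum-BoseEin-0a6d29ed-0)
- 2026-08-15T13:38:45Z · CLOSED retired — not-a-thesis: assembly does not conclude the sub-problem Statement (operator:999:1257524)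

sub-problem: BoseEinsteinCondensation · status: closed(retired) · opened planner-plancard-AtomisticToContinuum-BoseEin-0a6d29ed-0 2026-08-15T11:44:56Z · rev 2 · ledger route-AtomisticToContinuum-BECHierarchicalGluing
GENERATED by the gate from the ledger (D-0016/17). Provers cite these decls: `theorem foo : Summit.AtomisticToContinuum.BoseEinsteinCondensation.Theses.BECHierarchicalGluing.<Decl> := …` in Summits/AtomisticToContinuum/BoseEinsteinCondensation/Theorems/<Name>.lean.
-/

namespace Summit.AtomisticToContinuum.BoseEinsteinCondensation.Theses.BECHierarchicalGluing

open scoped BigOperators Topology Manifold Classical MeasureTheory ProbabilityTheory Matrix InnerProductSpace ComplexConjugate ContinuousMap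
open Filter Set Function TopologicalSpace MeasureTheory

attribute [summit_statement] _root_.BoseEinsteinCondensation

/-- item stmt-AtomisticToContinuum-6186 · crux · rank 2 · closed · moot by None · by planner
why it might fail: level-1 blocks are supersites with U_eff = 2q/b, hopping q²/b: mean-field Mott lobes at fillings k/b when q(b−1) ≲ 0.34 (inside q b² > 1 for q < 0.049, b = 8); if incoherent low levels feed E_J ∝ f_ℓ → 0 upward, no window ν₀ works.
sources: Leggett2001, FisherEtAl1989, Penrose1991, BleherMajor1984, MaghrebiGongGorshkov2017
[crux] card H1 in typed form. For b ≥ 2, 0 < q < 1 with q b² > 1 there are ν₀ > 0 and, for every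
filling floor 0 < ν₁ ≤ ν₀, a rate 0 ≤ θ < 1 and C such that for every depth M, every N with ν₁ b^M ≤
N ≤ ν₀ b^M and every sector-N ground state v of H (Rayleigh minimiser in the sector; unique and
positive by Perron–Frobenius), at every level ℓ < M and for every pair of SIBLING blocks B ≠ B′ of
level ℓ (same parent), with A_B = Σ_(y∈B) a_y: Re⟨v, A_B† A_B′ v⟩ ≥ 0 and Re⟨v, A_B† A_B′ v⟩ ≥ (1 −
C θ^(ℓ+1)) · ½(⟨v, A_B† A_B v⟩ + ⟨v, A_B′† A_B′ v⟩). Predicted θ = (q b²)^(−1/2) (zero-point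
relative phase of sibling rotors, ½⟨δθ²⟩ ≍ ½√(E_C/E_J)); big blocks are MORE coherent. [difficulty:
L] -/
@[route_item "route-AtomisticToContinuum-BECHierarchicalGluing"]
def SiblingCoherence : Prop :=
  ∀ b : ℕ, 2 ≤ b → ∀ q : ℝ, 0 < q → q < 1 → 1 < q * (b : ℝ) ^ 2 → ∃ ν₀ : ℝ, 0 < ν₀ ∧ ∀ ν₁ : ℝ, 0 < ν₁ → ν₁ ≤ ν₀ → ∃ θ : ℝ, 0 ≤ θ ∧ θ < 1 ∧ ∃ C : ℝ, ∀ M : ℕ, 1 ≤ M → ∀ N : ℕ, ν₁ * (b : ℝ) ^ M ≤ (N : ℝ) → (N : ℝ) ≤ ν₀ * (b : ℝ) ^ M → ∀ (H : Literature.MathematicalPhysics.QuantumLattice.Op (Fin M → Fin b) 2) (A : ℕ → (Fin M → Fin b) → Literature.MathematicalPhysics.QuantumLattice.Op (Fin M → Fin b) 2), H = (∑ n : Fin M, ∑ x : Fin M → Fin b, ∑ y : Fin M → Fin b, (if (∀ i : Fin M, n.val < i.val → x i = y i) then ((q : ℂ) ^ (n.val + 1) * ((if x = y then (1 : ℂ)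 else 0) - ((b : ℂ) ^ (n.val + 1))⁻¹)) else 0) • (Literature.MathematicalPhysics.QuantumLattice.onSite x (Literature.MathematicalPhysics.QuantumLattice.spinRaise 1) * Literature.MathematicalPhysics.QuantumLattice.onSite y (Literature.MathematicalPhysics.QuantumLattice.spinLower 1))) → A = (fun (ℓ : ℕ) (z : Fin M → Fin b) => ∑ y : Fin M → Fin b, if (∀ i : Fin M, ℓ ≤ i.val → y i = z i) then Literature.MathematicalPhysics.QuantumLattice.onSite y (Literature.MathematicalPhysics.QuantumLattice.spinLower 1) else 0) → ∀ v : ((Fin M → Fin b) → Fin 2) → ℂ, (∀ σ : (Fin M → Fin b) → Fin 2, (Finset.univ.filter fun x => σ x = 0).card ≠ N → v σ = 0) → v ≠ 0 → (∀ w : ((Fin M → Fin b) → Fin 2) → ℂ, (∀ σ : (Fin M → Fin b) → Fin 2, (Finset.univ.filter fun x => σ x = 0).card ≠ N → w σ = 0) → (star v ⬝ᵥ H.mulVec v).re * (star w ⬝ᵥ w).re ≤ (star w ⬝ᵥ H.mulVec w).re * (star v ⬝ᵥ v).re) → ∀ ℓ : ℕ, ℓ < M → ∀ x x' : Fin M →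 Fin b, (∀ i : Fin M, ℓ + 1 ≤ i.val → x i = x' i) → ¬ (∀ i : Fin M, ℓ ≤ i.val → x i = x' i) → 0 ≤ (star v ⬝ᵥ ((A ℓ x)ᴴ * A ℓ x').mulVec v).re ∧ (1 - C * θ ^ (ℓ + 1)) * (((star v ⬝ᵥ ((A ℓ x)ᴴ * A ℓ x).mulVec v).re + (star v ⬝ᵥ ((A ℓ x')ᴴ * A ℓ x').mulVec v).re) / 2) ≤ (star v ⬝ᵥ ((A ℓ x)ᴴ * A ℓ x').mulVec v).re

/-- item stmt-AtomisticToContinuum-6187 · crux · rank 3 · closed · moot by None · by planner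
why it might fail: needs a LOWER bound on block charging energies (finite compressibility of superfluid sub-blocks, E_C ≥ c b^(−ℓ)) and an upper bound on coherence of strongly quantum rotors uniformly in the sub-block state; near q b² = 1 the crossover level diverges and constants must not.
sources: MaghrebiGongGorshkov2017, Dyson1969, Leggett2001, PitaevskiiStringari1991
[crux] the dial (card H2, negative side). For b ≥ 2 and 0 < q with q b² < 1 (d_s < 1; on a line:
coupling exponent > 3), at every filling floor ν₁ > 0 the zero-mode fraction of the sector ground
state tends to 0: ∀ c > 0 ∃ M₀ ∀ M ≥ M₀ ∀ N ≥ ν₁ b^M: b^(−M)⟨v, Σ_(x,y) a†_x a_y v⟩ ≤ c N ⟨v, v⟩.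
Mechanism: E_C/E_J GROWS like (q b²)^(−ℓ), sibling phases at the top levels are quantum-disordered
rotors, and CoherenceTelescoping's factors stay below 1 − η at every high level. [difficulty: L] -/
@[route_item "route-AtomisticToContinuum-BECHierarchicalGluing"]
def NoCondensationBelowThreshold : Prop :=
  ∀ b : ℕ, 2 ≤ b → ∀ q : ℝ, 0 < q → q * (b : ℝ) ^ 2 < 1 → ∀ ν₁ : ℝ, 0 < ν₁ → ∀ c : ℝ, 0 < c → ∃ M₀ : ℕ, ∀ M : ℕ, M₀ ≤ M → ∀ N : ℕ, ν₁ * (b : ℝ) ^ M ≤ (N : ℝ) → ∀ (H P : Literature.MathematicalPhysics.QuantumLattice.Op (Fin M → Fin b) 2), H = (∑ n : Fin M, ∑ x : Fin M → Fin b, ∑ y : Fin M → Fin b, (if (∀ i : Fin M, n.val < i.val → x i = y i) then ((q : ℂ) ^ (n.val + 1) * ((if x = y then (1 : ℂ) else 0) - ((b : ℂ) ^ (n.val + 1))⁻¹)) else 0) • (Literature.MathematicalPhysics.QuantumLattice.onSite x (Literature.MathematicalPhysics.QuantumLattice.spinRaise 1) * Literature.MathematicalPhysics.QuantumLattice.onSite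 y (Literature.MathematicalPhysics.QuantumLattice.spinLower 1))) → P = (∑ x : Fin M → Fin b, ∑ y : Fin M → Fin b, Literature.MathematicalPhysics.QuantumLattice.onSite x (Literature.MathematicalPhysics.QuantumLattice.spinRaise 1) * Literature.MathematicalPhysics.QuantumLattice.onSite y (Literature.MathematicalPhysics.QuantumLattice.spinLower 1)) → ∀ v : ((Fin M → Fin b) → Fin 2) → ℂ, (∀ σ : (Fin M → Fin b) → Fin 2, (Finset.univ.filter fun x => σ x = 0).card ≠ N → v σ = 0) → v ≠ 0 → (∀ w : ((Fin M → Fin b) → Fin 2) → ℂ, (∀ σ : (Fin M → Fin b) → Fin 2, (Finset.univ.filter fun x => σ x = 0).card ≠ N → w σ = 0) → (star v ⬝ᵥ H.mulVec v).re * (star w ⬝ᵥ w).re ≤ (star w ⬝ᵥ H.mulVec w).re * (star v ⬝ᵥ v).re) → ((b : ℝ) ^ M)⁻¹ * (star v ⬝ᵥ P.mulVec v).re ≤ c * N * (star v ⬝ᵥ v).re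

/-- item stmt-AtomisticToContinuum-6188 · crux · rank 4 · closed · moot by None · by planner
why it might fail: for 1 < d_s ≤ 2 (b⁻² < q ≤ b⁻¹) the dilute limit is strongly coupled (c(ν₁) → 0 as ν₁ → 0, Tonks-like), so any proof uniform in the window must be non-perturbative at the ~log_b(1/ν₁) lowest populated levels; commensurate supersite lobes bound ν₀(b, q) above.
sources: Penrose1991, Toth1990, Kirson2000, BruDorlas2003, BleherMajor1989, Dyson1969
[crux] the rung theorem (card THEOREM-CANDIDATE HierBEC, hard-core form). For b ≥ 2, 0 < q < 1, q b²
> 1: ∃ ν₀ > 0 ∀ ν₁ ∈ (0, ν₀] ∃ c > 0 ∀ M ≥ 1 ∀ N with ν₁ b^M ≤ N ≤ ν₀ b^M, every sector-N ground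
state v of H has b^(−M) Re⟨v, (Σ_(x,y) a†_x a_y) v⟩ ≥ c N ⟨v, v⟩ (occupation of the block-constant
top mode a_Λ = b^(−M/2) Σ_x a_x, i.e. λ_max(γ) ≥ cN; maximal possible value N(1 − ρ) + ρ). Follows
from SiblingCoherence + CoherenceTelescoping (Π_ℓ max(1/b, 1 − (1−1/b)Cθ^(ℓ+1)) > 0 uniformly in M);
a DIRECT proof by a different engine (Tóth's random-stirring / interchange representation on the
hierarchy, or a Bleher–Major-type recursion on block generating functions) is equally welcome.
[deps: SiblingCoherence, CoherenceTelescoping] [difficulty: L] -/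
@[route_item "route-AtomisticToContinuum-BECHierarchicalGluing"]
def HierCondensation : Prop :=
  ∀ b : ℕ, 2 ≤ b → ∀ q : ℝ, 0 < q → q < 1 → 1 < q * (b : ℝ) ^ 2 → ∃ ν₀ : ℝ, 0 < ν₀ ∧ ∀ ν₁ : ℝ, 0 < ν₁ → ν₁ ≤ ν₀ → ∃ c : ℝ, 0 < c ∧ ∀ M : ℕ, 1 ≤ M → ∀ N : ℕ, ν₁ * (b : ℝ) ^ M ≤ (N : ℝ) → (N : ℝ) ≤ ν₀ * (b : ℝ) ^ M → ∀ (H P : Literature.MathematicalPhysics.QuantumLattice.Op (Fin M → Fin b) 2), H = (∑ n : Fin M, ∑ x : Fin M → Fin b, ∑ y : Fin M → Fin b, (if (∀ i : Fin M, n.val < i.val → x i = y i) then ((q : ℂ) ^ (n.val + 1) * ((if x = y then (1 : ℂ) else 0) - ((b : ℂ) ^ (n.val + 1))⁻¹)) else 0) • (Literature.MathematicalPhysics.QuantumLattice.onSite x (Literature.MathematicalPhysics.QuantumLattice.spinRaise 1) * Literature.MathematicalPhysics.QuantumLattice.onSite y (Literature.MathematicalPhysics.QuantumLattice.spinLower 1)))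 → P = (∑ x : Fin M → Fin b, ∑ y : Fin M → Fin b, Literature.MathematicalPhysics.QuantumLattice.onSite x (Literature.MathematicalPhysics.QuantumLattice.spinRaise 1) * Literature.MathematicalPhysics.QuantumLattice.onSite y (Literature.MathematicalPhysics.QuantumLattice.spinLower 1)) → ∀ v : ((Fin M → Fin b) → Fin 2) → ℂ, (∀ σ : (Fin M → Fin b) → Fin 2, (Finset.univ.filter fun x => σ x = 0).card ≠ N → v σ = 0) → v ≠ 0 → (∀ w : ((Fin M → Fin b) → Fin 2) → ℂ, (∀ σ : (Fin M → Fin b) → Fin 2, (Finset.univ.filter fun x => σ x = 0).card ≠ N → w σ = 0) → (star v ⬝ᵥ H.mulVec v).re * (star w ⬝ᵥ w).re ≤ (star w ⬝ᵥ H.mulVec w).re * (star v ⬝ᵥ v).re) → c * N * (star v ⬝ᵥ v).re ≤ ((b : ℝ) ^ M)⁻¹ * (star v ⬝ᵥ P.mulVec v).re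

/-- item stmt-AtomisticToContinuum-0686 · crux · rank 5 · open · by planner
why it might fail: it is the open problem; in the continuum the inter-block coupling does NOT factor through block modes (boundary couplings, all momenta), so the per-scale engine that is an identity here is conjectural there (KineticGapLengthScales bites at each scale if only energy is used).
sources: LSSY2005, Fournais2020, Junge2026, Leggett2001
X_B1: zero-mode macroscopic occupation. For every repulsive finite-range v, at all small densities
ρ, for all large N there is δ > 0 such that every δ-near-minimiser Ψ of the Dirichlet N-body energy
in the box of side (N/ρ)^{1/3} has ⟨φ₀, γ_Ψ φ₀⟩ ≥ cN for the normalised constant mode φ₀ =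
L^{-3/2}·1_box (c > 0 depending on v, ρ). -/
@[route_item "route-AtomisticToContinuum-BECHierarchicalGluing"]
def ZeroModeOccupation : Prop :=
  ∀ v : ℝ → ENNReal, Literature.MathematicalPhysics.QuantumManyBody.BoseGas.IsRepulsiveFiniteRange v → ∃ ρ₀ : ℝ, 0 < ρ₀ ∧ ∀ ρ : ℝ, 0 < ρ → ρ < ρ₀ → ∃ c : ℝ, 0 < c ∧ ∀ᶠ N : ℕ in Filter.atTop, ∃ δ : ENNReal, 0 < δ ∧ ∀ Ψ : Literature.MathematicalPhysics.QuantumManyBody.BoseGas.TrialState N (Literature.MathematicalPhysics.QuantumManyBody.BoseGas.sideLength ρ N), Literature.MathematicalPhysics.QuantumManyBody.BoseGas.energy v Ψ ≤ Literature.MathematicalPhysics.QuantumManyBody.BoseGas.groundStateEnergy v N (Literature.MathematicalPhysics.QuantumManyBody.BoseGas.sideLength ρ N) + δ → ENNReal.ofReal (c * N) ≤ Literature.MathematicalPhysics.QuantumManyBody.BoseGas.occupation N ((Literature.MathematicalPhysics.QuantumManyBody.BoseGas.box (Literature.MathematicalPhysics.QuantumManyBody.BoseGas.sideLength ρ N)).indicator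 fun _ => ((Real.sqrt (Literature.MathematicalPhysics.QuantumManyBody.BoseGas.sideLength ρ N ^ 3))⁻¹ : ℂ)) Ψ.ψ

/-- item stmt-AtomisticToContinuum-6189 · support · rank 9 · closed · moot by None · by planner
sources: PenroseOnsager1956, Leggett2001
[support] exact block bookkeeping, ANY vector v, any ε : ℕ → ℝ: if at every level ℓ < M every
sibling pair (B, B′) has Re⟨A_B† A_B′⟩ ≥ 0 and Re⟨A_B† A_B′⟩ ≥ (1 − ε_ℓ)·½(⟨A_B†A_B⟩ + ⟨A_B′†A_B′⟩),
then ⟨Σ_x a†_x a_x⟩ · Π_(ℓ<M) max(1/b, 1 − (1 − 1/b) ε_ℓ) ≤ b^(−M) ⟨Σ_(x,y) a†_x a_y⟩ (because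
A_parent = Σ_children A_B exactly: Σ_(j,k) G_jk ≥ b·max(1/b, 1 − (1−1/b)ε)·Σ_j G_jj, iterated from
sites to Λ). Finite sums and Cauchy–Schwarz only. [difficulty: provable-now] -/
@[route_item "route-AtomisticToContinuum-BECHierarchicalGluing"]
def CoherenceTelescoping : Prop :=
  ∀ (M b : ℕ), 1 ≤ b → ∀ (ε : ℕ → ℝ) (A : ℕ → (Fin M → Fin b) → Literature.MathematicalPhysics.QuantumLattice.Op (Fin M → Fin b) 2), A = (fun (ℓ : ℕ) (z : Fin M → Fin b) => ∑ y : Fin M → Fin b, if (∀ i : Fin M, ℓ ≤ i.val → y i = z i) then Literature.MathematicalPhysics.QuantumLattice.onSite y (Literature.MathematicalPhysics.QuantumLattice.spinLower 1) else 0) → ∀ v : ((Fin M → Fin b) → Fin 2) → ℂ, (∀ ℓ : ℕ, ℓ < M → ∀ x x' : Fin M → Fin b, (∀ i : Fin M, ℓ + 1 ≤ i.val → x i = x' i) → ¬ (∀ i : Fin M, ℓ ≤ i.val → x i = x' i) → 0 ≤ (star v ⬝ᵥ ((A ℓ x)ᴴ * A ℓ x').mulVec v).re ∧ (1 - ε ℓ)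 * (((star v ⬝ᵥ ((A ℓ x)ᴴ * A ℓ x).mulVec v).re + (star v ⬝ᵥ ((A ℓ x')ᴴ * A ℓ x').mulVec v).re) / 2) ≤ (star v ⬝ᵥ ((A ℓ x)ᴴ * A ℓ x').mulVec v).re) → (star v ⬝ᵥ (∑ x : Fin M → Fin b, (A 0 x)ᴴ * A 0 x).mulVec v).re * ∏ ℓ ∈ Finset.range M, max ((b : ℝ)⁻¹) (1 - (1 - (b : ℝ)⁻¹) * ε ℓ) ≤ ((b : ℝ) ^ M)⁻¹ * (star v ⬝ᵥ (∑ x : Fin M → Fin b, ∑ y : Fin M → Fin b, (A 0 x)ᴴ * A 0 y).mulVec v).re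

/-- item stmt-AtomisticToContinuum-6190 · support · rank 9 · closed · moot by None · by planner
sources: Penrose1991, Toth1990, Tasaki2020
[support] level 1 = complete graph K_b (card H0): for M = 1, H = q(N̂ − b⁻¹ S⁺_tot S⁻_tot), so every
sector-N Rayleigh minimiser (N ≤ b) maximises ⟨S⁺S⁻⟩ = S(S+1) − m² + m at S = b/2, m = N − b/2: ⟨v,
Σ_(x,y) a†_x a_y v⟩ = N(b − N + 1)⟨v, v⟩ exactly (Dicke states; condensate fraction (b − N + 1)/b,
gap q·1 in every sector). [difficulty: provable-now] -/
@[route_item "route-AtomisticToContinuum-BECHierarchicalGluing"]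
def LevelOneDicke : Prop :=
  ∀ b : ℕ, 1 ≤ b → ∀ q : ℝ, 0 < q → ∀ N : ℕ, N ≤ b → ∀ (H P : Literature.MathematicalPhysics.QuantumLattice.Op (Fin 1 → Fin b) 2), H = (∑ n : Fin 1, ∑ x : Fin 1 → Fin b, ∑ y : Fin 1 → Fin b, (if (∀ i : Fin 1, n.val < i.val → x i = y i) then ((q : ℂ) ^ (n.val + 1) * ((if x = y then (1 : ℂ) else 0) - ((b : ℂ) ^ (n.val + 1))⁻¹)) else 0) • (Literature.MathematicalPhysics.QuantumLattice.onSite x (Literature.MathematicalPhysics.QuantumLattice.spinRaise 1) * Literature.MathematicalPhysics.QuantumLattice.onSite y (Literature.MathematicalPhysics.QuantumLattice.spinLower 1))) → P = (∑ x : Fin 1 → Fin b, ∑ y : Fin 1 → Fin b, Literature.MathematicalPhysics.QuantumLattice.onSite x (Literature.MathematicalPhysics.QuantumLattice.spinRaise 1) * Literature.MathematicalPhysics.QuantumLattice.onSite y (Literature.MathematicalPhysics.QuantumLattice.spinLower 1)) → ∀ v : ((Fin 1 → Fin b) → Fin 2) → ℂ, (∀ σ : (Fin 1 → Fin b) → Fin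 2, (Finset.univ.filter fun x => σ x = 0).card ≠ N → v σ = 0) → v ≠ 0 → (∀ w : ((Fin 1 → Fin b) → Fin 2) → ℂ, (∀ σ : (Fin 1 → Fin b) → Fin 2, (Finset.univ.filter fun x => σ x = 0).card ≠ N → w σ = 0) → (star v ⬝ᵥ H.mulVec v).re * (star w ⬝ᵥ w).re ≤ (star w ⬝ᵥ H.mulVec w).re * (star v ⬝ᵥ v).re) → (star v ⬝ᵥ P.mulVec v).re = (N : ℝ) * ((b : ℝ) - N + 1) * (star v ⬝ᵥ v).re

/-- item stmt-AtomisticToContinuum-6191 · support · rank 9 · closed · moot by None · by planner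
sources: Tasaki2020, Penrose1991
[support] exactness of the recursion (the audits' cheap test (b), typed): for levels ℓ′ ≤ ℓ and any
sites x, z, the level-ℓ block hopping form Σ_(y,y′∈B_ℓ(x)) a†_y a_y′ = S⁺_B S⁻_B commutes with the
total-spin Casimir Σ_α (Σ_(w∈B_ℓ′(z)) S^α_w)² of the level-ℓ′ block of z (blocks are nested or
disjoint; S⁺_B S⁻_B = S_B² − (S³_B)² + S³_B is a polynomial in the components of S_B = S_B′ +
S_rest). Hence every level-n term of H conserves all lower-level block Casimirs: sub-blocks enter
only through their total spins. [difficulty: provable-now] -/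
@[route_item "route-AtomisticToContinuum-BECHierarchicalGluing"]
def CasimirConservation : Prop :=
  ∀ (M b ℓ ℓ' : ℕ), ℓ' ≤ ℓ → ∀ x z : Fin M → Fin b, Commute (∑ y : Fin M → Fin b, ∑ y' : Fin M → Fin b, (if (∀ i : Fin M, ℓ ≤ i.val → y i = x i) ∧ (∀ i : Fin M, ℓ ≤ i.val → y' i = x i) then Literature.MathematicalPhysics.QuantumLattice.onSite y (Literature.MathematicalPhysics.QuantumLattice.spinRaise 1) * Literature.MathematicalPhysics.QuantumLattice.onSite y' (Literature.MathematicalPhysics.QuantumLattice.spinLower 1) else (0 : Literature.MathematicalPhysics.QuantumLattice.Op (Fin M → Fin b) 2))) (∑ α : Fin 3, (∑ w : Fin M → Fin b, (if (∀ i : Fin M, ℓ' ≤ i.val → w i = z i) then Literature.MathematicalPhysics.QuantumLattice.siteSpin 1 w α else (0 : Literature.MathematicalPhysics.QuantumLattice.Op (Fin M → Fin b) 2))) ^ 2)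

/-- item stmt-AtomisticToContinuum-6192 · assembly · rank 1 · closed · moot by None · by planner
sources: LSSY2005, PenroseOnsager1956
[assembly] SiblingCoherence → CoherenceTelescoping → HierCondensation → ZeroModeOccupation →
BoseEinsteinCondensation. -/
@[route_item "route-AtomisticToContinuum-BECHierarchicalGluing"]
def Assembly : Prop :=
  SiblingCoherence → CoherenceTelescoping → HierCondensation → ZeroModeOccupation → Literature.MathematicalPhysics.QuantumManyBody.BoseGas.BoseEinsteinCondensation

end Summit.AtomisticToContinuum.BoseEinsteinCondensation.Theses.BECHierarchicalGluing
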